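import Summits.BirchSwinnertonDyer.BirchSwinnertonDyer.Theorems.SignedLowerHalvesSmallImageLowerHalfBothSignsRttCharRoadE2JunctionFourTerm
import Summits.BirchSwinnertonDyer.BirchSwinnertonDyer.Theorems.SignedLowerHalvesSmallImageLowerHalfBothSignsRttD2SpecialisationHKEq
import HarnessLib

/-!
# Route `SignedLowerHalves`, crux L `SmallImageLowerHalfBothSigns` (stmt-BirchSwinnertonDyer-23599), line `rtt_w3` v14 → v15 — E2, DEPLETED junction, row J2⁺:
# THE LOCAL COUNT — `λ(Λ_𝒪 ⧸ (∏ E_w)) = Σ λ(Λ_𝒪 ⧸ (E_w))` and `λ(M × N) = λ(M) + λ(N)`, so that `hE : λ(Λ_𝒪 ⧸ (E)) ≤ λ(Hloc)` of the four-term socket is bookkeeping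
# once each local module is `Λ_𝒪 ⧸ (E_w)`

WHY (LEAD `cruxlead-stmt-BirchSwinnertonDyer-23599` g11; BRIEF-E2 rev 5.2 §3 row J2⁺; socket `lambdaInvariant_add_le_of_fourTerm` p784625). In E2, `Hloc = ⊕_{w∈S₀K} 𝐇¹(K_{∞,w}, T*)`
with each summand cyclic `≅ Λ_𝒪/(E_w)` (rank-one `T*`, `p ≥ 5`) and `E = ∏ E_w`. ★★ `lambdaInvariant_quotient_span_singleton_mul`: `λ(Λ_𝒪/(fg)) = λ(Λ_𝒪/(f)) + λ(Λ_𝒪/(g))`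
(`0 → Λ_𝒪/(g) —·f→ Λ_𝒪/(fg) → Λ_𝒪/(f) → 0`, `Λ_𝒪` a domain); ★★ `lambdaInvariant_quotient_span_singleton_prod` (finite products); ★ `lambdaInvariant_prod_eq_add`
(`λ(M × N) = λ(M) + λ(N)` for f.g. torsion `Λ`-modules).

THEOREMS ONLY (`--supports stmt-BirchSwinnertonDyer-23599` helper); closes nothing; crux L, crux M, E2 and BSD remain OPEN and are proved for NO curve by any of this.
[cite: Washington1997, §13.2] [cite: GreenbergVatsal2000, §2 Prop. (2.4)] [folklore]
-/

set_option autoImplicit false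
-- the Theorems namespace of this sub repeats the summit name by design (D-0017 nested layout)
set_option linter.dupNamespace false

noncomputable section

open Literature.NumberTheory.EllipticCurves Literature.NumberTheory.EllipticCurves.IwasawaDual
open Summit.BirchSwinnertonDyer.Rank1Residual.X2.DualRestrictionInvariants (lambdaInvariant_eq_add_of_surjective)

namespace Summit.BirchSwinnertonDyer.BirchSwinnertonDyer.Theorems.SmallImageRttCharRoad

universe u₁ u₂ u₃

variable {p : ℕ} [Fact p.Prime]

/-! ## §1 Products of `Λ`-modules -/

section Prod

variable {M : Type u₁} {N : Type u₂} [AddCommGroup M] [Module (IwasawaAlgebra p) M] [AddCommGroup N] [Module (IwasawaAlgebra p) N]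

/-- ★ **`λ(M × N) = λ(M) + λ(N)`** for finitely generated torsion `Λ`-modules (`0 → N → M × N → M → 0`). [cite: Washington1997, §13.2] [folklore] -/
theorem lambdaInvariant_prod_eq_add [Module.Finite (IwasawaAlgebra p) M] [Module.Finite (IwasawaAlgebra p) N]
    (hM : Module.IsTorsion (IwasawaAlgebra p) M) (hN : Module.IsTorsion (IwasawaAlgebra p) N) :
    lambdaInvariant p (M × N) = lambdaInvariant p M + lambdaInvariant p N := by
  have ht : Module.IsTorsion (IwasawaAlgebra p) (M × N) := by
    rintro ⟨x, y⟩
    obtain ⟨⟨a, ha⟩, hax⟩ := @hM x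
    obtain ⟨⟨b, hb⟩, hby⟩ := @hN y
    refine ⟨⟨a * b, mul_mem ha hb⟩, ?_⟩
    change a • x = 0 at hax
    change b • y = 0 at hby
    change (a * b) • (x, y) = 0
    rw [Prod.smul_mk, mul_comm a b, mul_smul, hax, smul_zero, mul_comm b a, mul_smul, hby, smul_zero, Prod.mk_zero_zero]
  have h := lambdaInvariant_eq_add_of_surjective p (LinearMap.fst (IwasawaAlgebra p) M N) ht Prod.fst_surjective
  have e : LinearMap.ker (LinearMap.fst (IwasawaAlgebra p) M N) ≃ₗ[IwasawaAlgebra p] N :=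
    (LinearEquiv.ofEq _ _ (LinearMap.ker_fst (R := IwasawaAlgebra p) (M := M) (M₂ := N))).trans
      (LinearEquiv.ofInjective (LinearMap.inr (IwasawaAlgebra p) M N) LinearMap.inr_injective).symm
  rw [h, lambdaInvariant_eq_of_linearEquiv e, add_comm]

end Prod

/-! ## §2 `λ(Λ_𝒪 ⧸ (fg)) = λ(Λ_𝒪 ⧸ (f)) + λ(Λ_𝒪 ⧸ (g))` -/

section Quot

variable {S : Set (PadicAlgCl p)} [FiniteDimensional ℚ_[p] (padicCoeffField S)] [Algebra (IwasawaAlgebra p) (IwasawaAlgebraO S)]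
  (halg : ∀ r : IwasawaAlgebra p, algebraMap (IwasawaAlgebra p) (IwasawaAlgebraO S) r = iwasawaToIwasawaO S r)

include halg in
/-- ★★ **`λ(Λ_𝒪 ⧸ (fg)) = λ(Λ_𝒪 ⧸ (f)) + λ(Λ_𝒪 ⧸ (g))`** for `f, g ≠ 0`: the sequence `0 → Λ_𝒪/(g) —·f→ Λ_𝒪/(fg) → Λ_𝒪/(f) → 0` is exact (`Λ_𝒪 = 𝒪⟦T⟧` a domain)
and `λ` is additive on finitely generated torsion `Λ`-modules. [cite: Washington1997, §13.2] [folklore] -/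
theorem lambdaInvariant_quotient_span_singleton_mul {f g : IwasawaAlgebraO S} (hf : f ≠ 0) (hg : g ≠ 0) :
    lambdaInvariant p (IwasawaAlgebraO S ⧸ Ideal.span {f * g}) =
      lambdaInvariant p (IwasawaAlgebraO S ⧸ Ideal.span {f}) + lambdaInvariant p (IwasawaAlgebraO S ⧸ Ideal.span {g}) := by
  haveI := moduleFinite_iwasawaAlgebraO S halg
  have hle : Ideal.span {f * g} ≤ Ideal.span {f} := Ideal.span_singleton_le_span_singleton.mpr (dvd_mul_right f g)
  -- the projection `π : Λ_𝒪/(fg) ↠ Λ_𝒪/(f)` and the multiplication `m : Λ_𝒪/(g) ↪ Λ_𝒪/(fg)`, `x ↦ f x`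
  let π : (IwasawaAlgebraO S ⧸ Ideal.span {f * g}) →ₗ[IwasawaAlgebraO S] (IwasawaAlgebraO S ⧸ Ideal.span {f}) :=
    Submodule.mapQ _ _ LinearMap.id hle
  have hπ : Function.Surjective π := fun y ↦ by
    obtain ⟨x, rfl⟩ := Submodule.Quotient.mk_surjective _ y
    exact ⟨Submodule.Quotient.mk x, rfl⟩
  have hcomap : Ideal.span {g} ≤ Submodule.comap (LinearMap.lsmul (IwasawaAlgebraO S) (IwasawaAlgebraO S) f) (Ideal.span {f * g}) := fun x hx ↦ by
    obtain ⟨a, rfl⟩ := Ideal.mem_span_singleton'.mp hx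
    rw [Submodule.mem_comap, LinearMap.lsmul_apply, smul_eq_mul]
    exact Ideal.mem_span_singleton'.mpr ⟨a, by ring⟩
  let m : (IwasawaAlgebraO S ⧸ Ideal.span {g}) →ₗ[IwasawaAlgebraO S] (IwasawaAlgebraO S ⧸ Ideal.span {f * g}) :=
    Submodule.mapQ _ _ (LinearMap.lsmul (IwasawaAlgebraO S) (IwasawaAlgebraO S) f) hcomap
  have hm_apply : ∀ x : IwasawaAlgebraO S, m (Submodule.Quotient.mk x) = Submodule.Quotient.mk (f * x) := fun x ↦ rfl
  have hm : Function.Injective m := by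
    rw [← LinearMap.ker_eq_bot, Submodule.eq_bot_iff]
    intro y hy
    obtain ⟨x, rfl⟩ := Submodule.Quotient.mk_surjective _ y
    rw [LinearMap.mem_ker, hm_apply, Submodule.Quotient.mk_eq_zero] at hy
    obtain ⟨a, ha⟩ := Ideal.mem_span_singleton'.mp hy
    have hx : x = a * g := mul_left_cancel₀ hf (by rw [← ha]; ring)
    rw [Submodule.Quotient.mk_eq_zero, hx]
    exact Ideal.mem_span_singleton'.mpr ⟨a, rfl⟩
  have hrange : LinearMap.range m = LinearMap.ker π := by
    apply le_antisymm
    · rintro _ ⟨y, rfl⟩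
      obtain ⟨x, rfl⟩ := Submodule.Quotient.mk_surjective _ y
      rw [LinearMap.mem_ker, hm_apply]
      change Submodule.Quotient.mk (f * x) = (0 : IwasawaAlgebraO S ⧸ Ideal.span {f})
      rw [Submodule.Quotient.mk_eq_zero]
      exact Ideal.mem_span_singleton'.mpr ⟨x, mul_comm x f⟩
    · intro y hy
      obtain ⟨x, rfl⟩ := Submodule.Quotient.mk_surjective _ y
      rw [LinearMap.mem_ker] at hy
      change Submodule.Quotient.mk x = (0 : IwasawaAlgebraO S ⧸ Ideal.span {f}) at hy
      rw [Submodule.Quotient.mk_eq_zero] at hy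
      obtain ⟨a, rfl⟩ := Ideal.mem_span_singleton'.mp hy
      exact ⟨Submodule.Quotient.mk a, by rw [hm_apply, mul_comm a f]⟩
  -- torsion of the middle term over `Λ`
  have ht : Module.IsTorsion (IwasawaAlgebra p) (IwasawaAlgebraO S ⧸ Ideal.span {f * g}) :=
    isTorsion_iwasawaAlgebraO_quotient_span_singleton S halg (mul_ne_zero hf hg)
  have h := lambdaInvariant_eq_add_of_surjective p (π.restrictScalars (IwasawaAlgebra p)) ht hπ
  have e : LinearMap.ker (π.restrictScalars (IwasawaAlgebra p)) ≃ₗ[IwasawaAlgebra p] (IwasawaAlgebraO S ⧸ Ideal.span {g}) :=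
    (LinearEquiv.ofEq _ ((LinearMap.range m).restrictScalars (IwasawaAlgebra p)) (by
      rw [LinearMap.ker_restrictScalars, hrange])).trans
      ((LinearEquiv.ofInjective (m.restrictScalars (IwasawaAlgebra p)) hm).trans
        (LinearEquiv.ofEq _ _ (LinearMap.range_restrictScalars m))).symm
  rw [h, lambdaInvariant_eq_of_linearEquiv e, add_comm]

include halg in
/-- ★★ **`λ(Λ_𝒪 ⧸ (∏_{i∈s} E i)) = Σ_{i∈s} λ(Λ_𝒪 ⧸ (E i))`** for nonzero `E i` — the local count of row J2⁺ with `E = ∏_{w∈S₀K} E_w`. [cite: Washington1997, §13.2]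
[cite: GreenbergVatsal2000, §2 Prop. (2.4)] [folklore] -/
theorem lambdaInvariant_quotient_span_singleton_prod {ι : Type u₃} (s : Finset ι) (E : ι → IwasawaAlgebraO S) (hE : ∀ i ∈ s, E i ≠ 0) :
    lambdaInvariant p (IwasawaAlgebraO S ⧸ Ideal.span {∏ i ∈ s, E i}) = ∑ i ∈ s, lambdaInvariant p (IwasawaAlgebraO S ⧸ Ideal.span {E i}) := by
  classical
  induction s using Finset.induction_on with
  | empty =>
    rw [Finset.prod_empty, Finset.sum_empty, Ideal.span_singleton_one]
    haveI : Subsingleton (IwasawaAlgebraO S ⧸ (⊤ : Ideal (IwasawaAlgebraO S))) := Submodule.Quotient.subsingleton_iff.mpr rfl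
    exact SmallImageRttD2LamSpec.lambdaInvariant_eq_zero_of_subsingleton p _
  | insert a s has ih =>
    rw [Finset.prod_insert has, Finset.sum_insert has,
      lambdaInvariant_quotient_span_singleton_mul halg (hE a (Finset.mem_insert_self a s))
        (Finset.prod_ne_zero_iff.mpr fun i hi ↦ hE i (Finset.mem_insert_of_mem hi)),
      ih fun i hi ↦ hE i (Finset.mem_insert_of_mem hi)]

end Quot

end Summit.BirchSwinnertonDyer.BirchSwinnertonDyer.Theorems.SmallImageRttCharRoad

end
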